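import Summits.QuantumFields.BalabanUV.Beta.SymCorrectorFaceGauge
import Summits.QuantumFields.BalabanUV.Beta.SymCorrectorRest

/-!
# `BalabanUV.Beta.SymCorrectorPairGauge` — binder row D1, road «BF-x» junction (J1), brick TT11: **THE PAIR FACE PIECES OF THE DOUBLY TRANSPORTED
# BI-STENCIL ARE THE OWNER's SECOND-ORDER GAUGE LETTERS `Wmix` ∕ `Wgg`** — under the rooted slot Ward letters of both slots (and the first-order letter of
# the first-slot partner), the three contact pieces of TT6 `SymCorrectorRest.slotPsiS₂_expand` are DIAGONAL CONTACTS `[T′, θ₁]`, `[T, θ₂]`, `[[𝕄, θ₃], θ₁]` with block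
# generators — the slot-level form of the `Wmix`∕`Wgg` letters of `D1BFx/ColumnGaugeInvariance.hessKer_columnGauge` (orientation `Λ := −Θ`, §3; the bi-vertices
# through `vertex2OfK K n` are the sequel TT12) (OWNER N-g23-2 (β′); COLUMN-GAUGE-INSTANCE-SPEC-g23 (W2-fine) (i))

THE MATHEMATICS.  TT4 (`SymCorrectorPair.vertex2OfK_conj_psiKS`) moves the `Ψ̂_S`-conjugation of the kernel onto BOTH slots of a bi-stencil family:
`vertex2OfK (Ψ̂KΨ̂ᵀ) n S₂ = vertex2OfK K n (α x ↦ slotPsiS r n (slotPsiS r n S₂ α x))`, and TT6 expands the doubly transported family into the raw table +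
OUTER-indexed + INNER-indexed + BOTH-indexed face pieces.  With the POINTWISE rooted slot Ward letters (the OWNER's shape, TT10):
first slot `hL : ∀ κ′ u′ u, divV (κ u ↦ S₂ κ u κ′ u′) u = ξ₁ • conjV (T′ κ′ u′) (diagK (legInd ρ u))` (partner `T′` — for a genuine second-partials table the
first-order table), second slot `hR : ∀ α x u′, divV (S₂ α x) u′ = ξ₂ • conjV (T α x) (diagK (legInd ρ u′))`, and the first-order letter of the partner
`hT : ∀ u′, divV T′ u′ = ξ₃ • conjV 𝕄 (diagK (legInd ρ u′))`:
* §1 entrywise linearity in the NON-diagonal argument of a diagonal contact (no hypotheses): `faceSum`∕`divV`∕`vertexOfK` of `κ u ↦ conjV (T κ u) (diagK g)`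
  is `conjV (faceSum ∕ divV ∕ vertexOfK of T) (diagK g)`; scalars move into the symbols;
* §2 **`slotPsiS₂_eq_add_contacts_of_letters`**: `slotPsiS r n (slotPsiS r n S₂ α x) κ′ u′ = S₂ α x κ′ u′ + conjV (T′ κ′ u′) (θ₁ α x) + conjV (T α x) (θ₂ κ′ u′)
  + conjV (conjV 𝕄 (θ₃ κ′ u′)) (θ₁ α x)`, `θᵢ β w := diagK (z b ↦ [blk n (legSite ρ z b) = blk n w]·(ξᵢ·faceWt r n β w))` (block contacts);
* §3 the OWNER's orientation: with `Λ := diagK (−symbol)`, `conjV V Θ′ + conjV V′ Θ = (Λ′∘V − V∘Λ′) + (Λ∘V′ − V′∘Λ)` (= `Wmix μ y ν y′`) and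
  `conjV (conjV 𝕄 Θ′) Θ = Λ∘G′ − G′∘Λ`, `G′ := Λ′∘𝕄 − 𝕄∘Λ′` (= `Wgg μ y ν y′`) — read off `ColumnGaugeInvariance.hessKer_columnGauge`'s statement.
The bi-vertices of the pieces through `vertex2OfK K n` (letter-free) and the ASSEMBLED `vertex2OfK K n (slot∘slot S₂) = vertex2OfK K n S₂ + (Wmix-pieces) + (Wgg-piece)`
are the sequel TT12 `SymCorrectorPairGaugeVertex`; the `mixOfK`∕`dM∘K2OfK` words of TT6∕TT8 (the (D-R) rest) are in neither.

HONEST DEPENDENCY (cell records, verbatim): «continuum YM on T⁴ ⇐ BetaPertH ∧ nine spine estimates (0/9 proved); BetaPertH ⇐ (D1) ∧ (D4) ∧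
CAP+tail; G-an2-4 gates asym, D1 and NE2/3/4.»  HONEST FRAMING (cell contract, verbatim): «discharging `BetaPertH` makes Bałaban's UV stability
UNCONDITIONAL — a real constructive-QFT result; it is NOT the continuum limit and NOT the Clay problem.»  THIS MODULE DISCHARGES NOTHING of (K), of
(J1)'s row, of D1 or of the wall: [folklore] entrywise identities between OUR kernels BY NAME; the three letters are HYPOTHESES — which bi-table obeys them
(the literal's `S₂⁰ = n⁸ • wilsonW₂ 3 ((8N²)⁻¹ • wsym22 N) + cB • tabs.vh₂S`: an3's ∕ leaf-05's `WilsonBiStencilGaugeLegZ` letters are FLUCTUATION-leg laws, the SLOT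
laws are the instance's located check) is NOT decided here.  No definition, no `def … : Prop`, nothing cited, 0 sorry.  0∕4 row-D1 binders; (K) NOT closed;
(J1) = ONE OPEN ROW; NOT D1, NEVER «G-an2-4 closed», NOT `BetaPertH`, NOT continuum, NOT Clay.

ABSOLUTE RULE (cell charter, verbatim): «No internally-minted statement may enter as a cited fact. Every hypothesis is either kernel-proved in this
package or a verbatim quotation of a PUBLISHED theorem with page reference. The manuscript(s) under audit are NOT citable for their own disputed
steps — they are the thing under adjudication; programme-internal (2001/route/tribunal) claims are never citable.»

D1 formalisation swarm LEAF 03 (`b2b-balaban-beta-d1-formalise-leaf-03`, gen 30), 2026-08-23; over TT10 `SymCorrectorFaceGauge`, TT6 `SymCorrectorRest`,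
an3's `VertexReflectionContact`, an2's `DiagonalContact` BY NAME; no existing file touched.
-/

open Finset
open scoped BigOperators
open Literature.MathematicalPhysics.QuantumFieldTheory
open Literature.MathematicalPhysics.QuantumFieldTheory.Balaban1983to89
open Literature.MathematicalPhysics.QuantumFieldTheory.Balaban1983to89.Beta
open ExpKernelCalculus (MKer Decays comp)
open OneStepResolventKernel (Fib wsum)
open B12Sec2to5 (l1 l1_nonneg)
open OneStepKernelFamily (colH vertexOfK)
open SecondOrderResponse (vertex2OfK)
open KernelWard (divV)
open AffineAveraging (Site box)
open AveragingContours (blk)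
open Summit.QuantumFields.BalabanUV.Beta.ChartConjugation (conjV)
open Summit.QuantumFields.BalabanUV.Beta.BorderedHessian (diagK diagK_apply conjV_diagK_apply comp_diagK_left comp_diagK_right)
open Summit.QuantumFields.BalabanUV.Beta.AveragingWardRootedStencils (legSite legInd)
open Summit.QuantumFields.BalabanUV.Beta.CompositeCorrectorLocality (blockSitesF)
open Summit.QuantumFields.BalabanUV.Beta.KernelWardRelative (gaugeWt)
open Summit.QuantumFields.BalabanUV.Beta.TameKernelCalculus (Spr trK)
open Summit.QuantumFields.BalabanUV.Beta.SymCorrectorKernel (psiKS)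
open Summit.QuantumFields.BalabanUV.Beta.SymCorrectorFace (faceWt faceWtSum faceWtSum_nonneg abs_faceWt_le faceSum slotPsiS)
open Summit.QuantumFields.BalabanUV.Beta.SymCorrectorRest (slotPsiS₂_expand)
open Summit.QuantumFields.BalabanUV.Beta.SymCorrectorFaceGauge (faceSum_eq_conjV_of_letters faceFamily_eq_conjV_of_letters conjV_diagK_eq_comm_neg)

namespace Summit.QuantumFields.BalabanUV.Beta.SymCorrectorPairGauge

noncomputable section

variable {d : ℕ} {n : ℕ}

/-! ## §1 Entrywise linearity in the non-diagonal argument of a diagonal contact -/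

/-- [folklore] The face sum of a family of diagonal contacts with a FIXED generator: `faceSum n (κ u ↦ conjV (T κ u) (diagK g)) Y = conjV (faceSum n T Y) (diagK g)`. -/
theorem faceSum_conjV_diagK_fixed (T : Fin (d + 1) → Site (d + 1) → MKer (d + 1) (Fib d)) (g : Site (d + 1) → Fib d → ℝ) (Y : Site (d + 1)) :
    faceSum n (fun κ u => conjV (T κ u) (diagK g)) Y = conjV (faceSum n T Y) (diagK g) := by
  funext p q a c
  simp only [faceSum, Finset.sum_apply, Pi.smul_apply, smul_eq_mul, conjV_diagK_apply]
  rw [Finset.sum_mul]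
  refine Finset.sum_congr rfl fun κ _ => ?_
  rw [Finset.sum_mul]
  refine Finset.sum_congr rfl fun u _ => ?_
  ring

/-- [folklore] The function-valued face sum evaluated at a second slot: `(faceSum n S₂ Y) κ′ u′ = faceSum n (κ u ↦ S₂ κ u κ′ u′) Y`. -/
theorem faceSum_apply₂ (S₂ : Fin (d + 1) → Site (d + 1) → Fin (d + 1) → Site (d + 1) → MKer (d + 1) (Fib d)) (Y : Site (d + 1))
    (κ' : Fin (d + 1)) (u' : Site (d + 1)) :
    faceSum n S₂ Y κ' u' = faceSum n (fun κ u => S₂ κ u κ' u') Y := by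
  simp only [faceSum, Finset.sum_apply, Pi.smul_apply]

/-- [folklore] The fine divergence of a family of diagonal contacts with a fixed generator: `divV (κ u ↦ conjV (T κ u) (diagK g)) w = conjV (divV T w) (diagK g)`. -/
theorem divV_conjV_diagK_fixed (T : Fin (d + 1) → Site (d + 1) → MKer (d + 1) (Fib d)) (g : Site (d + 1) → Fib d → ℝ) (w : Site (d + 1)) :
    divV (fun κ u => conjV (T κ u) (diagK g)) w = conjV (divV T w) (diagK g) := by
  funext p q a c
  simp only [KernelWard.divV, Finset.sum_apply, Pi.sub_apply, conjV_diagK_apply]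
  rw [Finset.sum_mul]
  refine Finset.sum_congr rfl fun κ _ => ?_
  ring

/-- [folklore] **THE CHAIN-RULE VERTEX OF A FAMILY OF DIAGONAL CONTACTS WITH A FIXED GENERATOR** (any `K`, no summability hypothesis — `tsum_mul_right`):
`vertexOfK K n (κ u ↦ conjV (T κ u) (diagK g)) μ y = conjV (vertexOfK K n T μ y) (diagK g)`. -/
theorem vertexOfK_conjV_diagK_fixed (K : MKer (d + 1) (Fib d)) (T : Fin (d + 1) → Site (d + 1) → MKer (d + 1) (Fib d)) (g : Site (d + 1) → Fib d → ℝ)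
    (μ : Fin (d + 1)) (y : Site (d + 1)) :
    vertexOfK K n (fun κ u => conjV (T κ u) (diagK g)) μ y = conjV (vertexOfK K n T μ y) (diagK g) := by
  funext p q a c
  simp only [vertexOfK, OneStepResolventKernel.wsum, conjV_diagK_apply]
  rw [Finset.sum_mul]
  refine Finset.sum_congr rfl fun κ _ => ?_
  rw [← tsum_mul_right]
  refine tsum_congr fun u => ?_
  ring

/-- [folklore] Scalars move into the two symbols of an iterated diagonal contact: `(a·b) • conjV (conjV 𝕄 (diagK g)) (diagK h) = conjV (conjV 𝕄 (diagK (b•g))) (diagK (a•h))`. -/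
theorem smul_conjV_conjV_diagK (a b : ℝ) (𝕄 : MKer (d + 1) (Fib d)) (g h : Site (d + 1) → Fib d → ℝ) :
    (a * b) • conjV (conjV 𝕄 (diagK g)) (diagK h) = conjV (conjV 𝕄 (diagK fun z c => b * g z c)) (diagK fun z c => a * h z c) := by
  funext p q e f
  simp only [Pi.smul_apply, smul_eq_mul, conjV_diagK_apply]
  ring

/-- [folklore] A scalar moves into the symbol of a diagonal contact: `a • conjV 𝕄 (diagK g) = conjV 𝕄 (diagK (a•g))`. -/
theorem smul_conjV_diagK' (a : ℝ) (𝕄 : MKer (d + 1) (Fib d)) (g : Site (d + 1) → Fib d → ℝ) :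
    a • conjV 𝕄 (diagK g) = conjV 𝕄 (diagK fun z c => a * g z c) := by
  funext p q e f
  simp only [Pi.smul_apply, smul_eq_mul, conjV_diagK_apply]
  ring

/-! ## §2 Under the slot letters: the doubly transported bi-stencil is the raw table plus three diagonal contacts -/

section Letters

variable (hn : 0 < n) (r : Fin (d + 1) → ℕ)
  {S₂ : Fin (d + 1) → Site (d + 1) → Fin (d + 1) → Site (d + 1) → MKer (d + 1) (Fib d)} {T T' : Fin (d + 1) → Site (d + 1) → MKer (d + 1) (Fib d)}
  {𝕄 : MKer (d + 1) (Fib d)} {ρ : Site (d + 1)} {ξ₁ ξ₂ ξ₃ : ℝ}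
  (hL : ∀ κ' u' u, divV (fun κ u => S₂ κ u κ' u') u = ξ₁ • conjV (T' κ' u') (diagK (legInd ρ u)))
  (hR : ∀ α x u', divV (S₂ α x) u' = ξ₂ • conjV (T α x) (diagK (legInd ρ u')))
  (hT : ∀ u', divV T' u' = ξ₃ • conjV 𝕄 (diagK (legInd ρ u')))
include hn

section OuterInner

include hL in
/-- [folklore] **THE OUTER-INDEXED FACE PIECE IS A CONTACT OF THE FIRST-SLOT PARTNER**: under `hL`,
`faceWt r n α x • (faceSum n S₂ (blk n x)) κ′ u′ = conjV (T′ κ′ u′) (θ₁ α x)`, `θ₁ α x := diagK (z b ↦ [blk n (legSite ρ z b) = blk n x]·(ξ₁·faceWt r n α x))`. -/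
theorem outerFace_eq_conjV_of_letters (α : Fin (d + 1)) (x : Site (d + 1)) (κ' : Fin (d + 1)) (u' : Site (d + 1)) :
    faceWt r n α x • faceSum n S₂ (blk n x) κ' u'
      = conjV (T' κ' u') (diagK fun z b => if blk n (legSite ρ z b) = blk n x then ξ₁ * faceWt r n α x else 0) := by
  rw [faceSum_apply₂]
  exact faceFamily_eq_conjV_of_letters hn (S := fun κ u => S₂ κ u κ' u') (hL κ' u') r α x

include hR in
/-- [folklore] **THE INNER-INDEXED FACE PIECE IS A CONTACT OF THE SECOND-SLOT PARTNER**: under `hR`,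
`faceWt r n κ′ u′ • faceSum n (S₂ α x) (blk n u′) = conjV (T α x) (θ₂ κ′ u′)`. -/
theorem innerFace_eq_conjV_of_letters (α : Fin (d + 1)) (x : Site (d + 1)) (κ' : Fin (d + 1)) (u' : Site (d + 1)) :
    faceWt r n κ' u' • faceSum n (S₂ α x) (blk n u')
      = conjV (T α x) (diagK fun z b => if blk n (legSite ρ z b) = blk n u' then ξ₂ * faceWt r n κ' u' else 0) :=
  faceFamily_eq_conjV_of_letters hn (hR α x) r κ' u'

include hL hT in
/-- [folklore] **THE BOTH-INDEXED (FACE × FACE) PIECE IS AN ITERATED CONTACT**: under `hL` and `hT`,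
`(faceWt r n α x·faceWt r n κ′ u′) • faceSum n (faceSum n S₂ (blk n x)) (blk n u′) = conjV (conjV 𝕄 (θ₃ κ′ u′)) (θ₁ α x)`. -/
theorem faceFace_eq_conjV_of_letters (α : Fin (d + 1)) (x : Site (d + 1)) (κ' : Fin (d + 1)) (u' : Site (d + 1)) :
    (faceWt r n α x * faceWt r n κ' u') • faceSum n (faceSum n S₂ (blk n x)) (blk n u')
      = conjV (conjV 𝕄 (diagK fun z b => if blk n (legSite ρ z b) = blk n u' then ξ₃ * faceWt r n κ' u' else 0))
          (diagK fun z b => if blk n (legSite ρ z b) = blk n x then ξ₁ * faceWt r n α x else 0) := by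
  -- the inner (first-slot) face sum is a family of contacts of `T′` with ONE fixed block generator
  have hin : faceSum n S₂ (blk n x) = fun κ' u' => conjV (T' κ' u') (diagK fun z b => if blk n (legSite ρ z b) = blk n x then ξ₁ else 0) := by
    funext κ' u'
    rw [faceSum_apply₂]
    exact faceSum_eq_conjV_of_letters hn (S := fun κ u => S₂ κ u κ' u') (hL κ' u') (blk n x)
  rw [hin, faceSum_conjV_diagK_fixed, faceSum_eq_conjV_of_letters hn hT (blk n u'), smul_conjV_conjV_diagK]
  have e1 : (fun z c => faceWt r n κ' u' * (if blk n (legSite ρ z c) = blk n u' then ξ₃ else 0))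
      = fun z c => if blk n (legSite ρ z c) = blk n u' then ξ₃ * faceWt r n κ' u' else 0 := by
    funext z c; split_ifs <;> ring
  have e2 : (fun z c => faceWt r n α x * (if blk n (legSite ρ z c) = blk n x then ξ₁ else 0))
      = fun z c => if blk n (legSite ρ z c) = blk n x then ξ₁ * faceWt r n α x else 0 := by
    funext z c; split_ifs <;> ring
  rw [e1, e2]

end OuterInner

include hL hR hT in
/-- [folklore] **THE DOUBLY TRANSPORTED BI-STENCIL IS THE RAW TABLE PLUS THREE DIAGONAL CONTACTS**: under `hL`, `hR`, `hT`, at every pair slot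
`slotPsiS r n (slotPsiS r n S₂ α x) κ′ u′ = S₂ α x κ′ u′ + conjV (T′ κ′ u′) (θ₁ α x) + conjV (T α x) (θ₂ κ′ u′) + conjV (conjV 𝕄 (θ₃ κ′ u′)) (θ₁ α x)`,
`θᵢ β w := diagK (z b ↦ [blk n (legSite ρ z b) = blk n w]·(ξᵢ·faceWt r n β w))` (TT6 `slotPsiS₂_expand` + §2's three pieces). -/
theorem slotPsiS₂_eq_add_contacts_of_letters (α : Fin (d + 1)) (x : Site (d + 1)) (κ' : Fin (d + 1)) (u' : Site (d + 1)) :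
    slotPsiS r n (slotPsiS r n S₂ α x) κ' u'
      = S₂ α x κ' u'
        + conjV (T' κ' u') (diagK fun z b => if blk n (legSite ρ z b) = blk n x then ξ₁ * faceWt r n α x else 0)
        + conjV (T α x) (diagK fun z b => if blk n (legSite ρ z b) = blk n u' then ξ₂ * faceWt r n κ' u' else 0)
        + conjV (conjV 𝕄 (diagK fun z b => if blk n (legSite ρ z b) = blk n u' then ξ₃ * faceWt r n κ' u' else 0))
            (diagK fun z b => if blk n (legSite ρ z b) = blk n x then ξ₁ * faceWt r n α x else 0) := by
  rw [slotPsiS₂_expand, outerFace_eq_conjV_of_letters hn r hL, innerFace_eq_conjV_of_letters hn r hR, faceFace_eq_conjV_of_letters hn r hL hT]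

include hL hR hT in
/-- [folklore] The same as an identity of families (the socket of TT4 `vertex2OfK_conj_psiKS`'s right-hand side). -/
theorem slotPsiS₂_eq_add_contacts_of_letters' :
    (fun α x => slotPsiS r n (slotPsiS r n S₂ α x))
      = fun α x κ' u' => S₂ α x κ' u'
        + conjV (T' κ' u') (diagK fun z b => if blk n (legSite ρ z b) = blk n x then ξ₁ * faceWt r n α x else 0)
        + conjV (T α x) (diagK fun z b => if blk n (legSite ρ z b) = blk n u' then ξ₂ * faceWt r n κ' u' else 0)
        + conjV (conjV 𝕄 (diagK fun z b => if blk n (legSite ρ z b) = blk n u' then ξ₃ * faceWt r n κ' u' else 0))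
            (diagK fun z b => if blk n (legSite ρ z b) = blk n x then ξ₁ * faceWt r n α x else 0) := by
  funext α x κ' u'
  exact slotPsiS₂_eq_add_contacts_of_letters hn r hL hR hT α x κ' u'

end Letters

/-! ## §3 The OWNER's orientation: `Wmix` and `Wgg` of `ColumnGaugeInvariance.hessKer_columnGauge` -/

/-- [folklore] **THE MIXED PIECES ARE `Wmix`**: with `Λ := diagK (−g)`, `Λ′ := diagK (−g′)`,
`conjV V (diagK g′) + conjV V′ (diagK g) = (Λ′∘V − V∘Λ′) + (Λ∘V′ − V′∘Λ)` — `hessKer_columnGauge`'s `Wmix μ y ν y′` at `V := V μ y`, `V′ := V ν y′`, `Λ := Λ μ y`, `Λ′ := Λ ν y′`. -/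
theorem mixed_eq_Wmix (V V' : MKer (d + 1) (Fib d)) (g g' : Site (d + 1) → Fib d → ℝ) :
    conjV V (diagK g') + conjV V' (diagK g)
      = (comp (diagK fun z b => -g' z b) V - comp V (diagK fun z b => -g' z b))
        + (comp (diagK fun z b => -g z b) V' - comp V' (diagK fun z b => -g z b)) := by
  rw [conjV_diagK_eq_comm_neg V g', conjV_diagK_eq_comm_neg V' g]

/-- [folklore] **THE FACE × FACE PIECE IS `Wgg`**: with `Λ := diagK (−g)`, `Λ′ := diagK (−g′)` and `G′ := Λ′∘𝕄 − 𝕄∘Λ′`,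
`conjV (conjV 𝕄 (diagK g′)) (diagK g) = Λ∘G′ − G′∘Λ` — `hessKer_columnGauge`'s `Wgg μ y ν y′`. -/
theorem faceFace_eq_Wgg (𝕄 : MKer (d + 1) (Fib d)) (g g' : Site (d + 1) → Fib d → ℝ) :
    conjV (conjV 𝕄 (diagK g')) (diagK g)
      = comp (diagK fun z b => -g z b) (comp (diagK fun z b => -g' z b) 𝕄 - comp 𝕄 (diagK fun z b => -g' z b))
        - comp (comp (diagK fun z b => -g' z b) 𝕄 - comp 𝕄 (diagK fun z b => -g' z b)) (diagK fun z b => -g z b) := by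
  rw [← conjV_diagK_eq_comm_neg 𝕄 g', conjV_diagK_eq_comm_neg (conjV 𝕄 (diagK g')) g]


end

end Summit.QuantumFields.BalabanUV.Beta.SymCorrectorPairGauge
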